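import Summits.ResolutionOfSingularities.ResolutionOfSingularities.Theorems.DeltaCutMirrorRigidity
import HarnessLib

/-!
# DeltaCutMirrorProbe — (B7) probes of the lens-6 g29 node «MirrorCut» (HOME
`decomp-res-lens-6/g29/MirrorRigidity.lean`, section `MProbe`)

Each of the three symmetry hypotheses of `mirror_rigidity` (mirror `σ̂`, Frobenius shears `τ̂_c`, scalings `μ̂_λ`)
is LOAD-BEARING: dropping one admits a
stable `w`-closed subset of `P_t ∪ P_w` outside the trichotomy `∅ / L / P_t ∪ P_w` — the origin (no shear: Kollár's
characteristic-zero escape), the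
plane `P_t` (no mirror: the non-equivariant law that decides `D′`), `L` plus two mirrored lines (no scaling).
Declarations verbatim from the lens file.
[new; elementary] [folklore]
-/


noncomputable section

open CategoryTheory CategoryTheory.Limits AlgebraicGeometry TopologicalSpace IsLocalRing
open Literature.AlgebraicGeometry.Resolution

universe u

namespace Summit.ResolutionOfSingularities.ResolutionOfSingularities.Theorems.DeltaCutClasses

section MProbe

variable {K : Type*} [Field K]

/-! #### (B7) PROBES — each symmetry hypothesis of `mirror_rigidity` is LOAD-BEARING (over any field; `d ∉ {0,1}` for the third)

Dropping ONE of the three stabilities admits a stable set outside the trichotomy `∅ / L / P_t ∪ P_w`, i.e. an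
ADMISSIBLE CENTRE for a
law that is equivariant only for the remaining symmetries: no shear ↦ the ORIGIN (Kollár's characteristic-zero
escape «blow up the closed
point», census ℓ₃); no mirror ↦ the plane `P_t` (the non-equivariant memoryless law that decides `D′`, census (B7));
no scaling ↦ `L` plus
the two mirrored lines `w = 1 ⊂ P_t`, `t = 1 ⊂ P_w`. [new; elementary] [folklore] -/

/-- **PROBE 1 — no Frobenius shear**: the origin is `σ̂`- and `μ̂`-stable, `w`-closed, inside `P_t ∪ P_w`, outside
the trichotomy,
and NOT `τ̂`-stable (any `p`: `τ̂_1` moves it). [new; elementary] [folklore] -/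
theorem mirror_probe_no_shear (p : ℕ) :
    ({pt4 0 0 0 0} : Set (Fin 4 → K)) ⊆ mirrorPt ∪ mirrorPw ∧
    (∀ x ∈ ({pt4 0 0 0 0} : Set (Fin 4 → K)), swapPt x ∈ ({pt4 0 0 0 0} : Set (Fin 4 → K))) ∧
    (∀ l : K, l ≠ 0 → ∀ x ∈ ({pt4 0 0 0 0} : Set (Fin 4 → K)), scaleWPt p l x ∈ ({pt4 0 0 0 0} : Set (Fin 4 → K))) ∧
    (∀ b : K, (∀ d : K, d ≠ 0 → pt4 0 0 b d ∈ ({pt4 0 0 0 0} : Set (Fin 4 → K))) → pt4 0 0 b 0 ∈ ({pt4 0 0 0 0} : Set (Fin 4 → K))) ∧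
    ({pt4 0 0 0 0} : Set (Fin 4 → K)) ≠ ∅ ∧ ({pt4 0 0 0 0} : Set (Fin 4 → K)) ≠ mirrorL ∧
    ({pt4 0 0 0 0} : Set (Fin 4 → K)) ≠ mirrorPt ∪ mirrorPw ∧
    ¬ (∀ c : K, ∀ x ∈ ({pt4 0 0 0 0} : Set (Fin 4 → K)), shearPt p c x ∈ ({pt4 0 0 0 0} : Set (Fin 4 → K))) := by
  refine ⟨?_, ?_, ?_, ?_, ?_, ?_, ?_, ?_⟩
  · intro x hx
    rw [Set.mem_singleton_iff] at hx
    subst hx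
    exact Or.inl ⟨by simp, by simp⟩
  · intro x hx
    rw [Set.mem_singleton_iff] at hx ⊢
    subst hx
    funext i; fin_cases i <;> simp [swapPt]
  · intro l _ x hx
    rw [Set.mem_singleton_iff] at hx ⊢
    subst hx
    funext i; fin_cases i <;> simp [scaleWPt]
  · intro b hb
    have h := hb 1 one_ne_zero
    rw [Set.mem_singleton_iff] at h
    have := congr_fun h 3
    simp at this
  · exact Set.singleton_ne_empty _
  · intro h
    have hmem : pt4 (0 : K) 0 1 0 ∈ (mirrorL : Set (Fin 4 → K)) := ⟨by simp, by simp, by simp⟩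
    rw [← h, Set.mem_singleton_iff] at hmem
    have := congr_fun hmem 2
    simp at this
  · intro h
    have hmem : pt4 (0 : K) 0 1 0 ∈ (mirrorPt ∪ mirrorPw : Set (Fin 4 → K)) := Or.inl ⟨by simp, by simp⟩
    rw [← h, Set.mem_singleton_iff] at hmem
    have := congr_fun hmem 2
    simp at this
  · intro h
    have h1 := h 1 _ (Set.mem_singleton _)
    rw [Set.mem_singleton_iff] at h1
    have := congr_fun h1 2
    simp [shearPt] at this

/-- **PROBE 2 — no mirror**: the plane `P_t` is `τ̂`- and `μ̂`-stable, `w`-closed, inside `P_t ∪ P_w`, outside the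
trichotomy, and NOT
`σ̂`-stable. [new; elementary] [folklore] -/
theorem mirror_probe_no_mirror (p : ℕ) :
    (mirrorPt : Set (Fin 4 → K)) ⊆ mirrorPt ∪ mirrorPw ∧
    (∀ c : K, ∀ x ∈ (mirrorPt : Set (Fin 4 → K)), shearPt p c x ∈ (mirrorPt : Set (Fin 4 → K))) ∧
    (∀ l : K, l ≠ 0 → ∀ x ∈ (mirrorPt : Set (Fin 4 → K)), scaleWPt p l x ∈ (mirrorPt : Set (Fin 4 → K))) ∧
    (∀ b : K, (∀ d : K, d ≠ 0 → pt4 0 0 b d ∈ (mirrorPt : Set (Fin 4 → K))) → pt4 0 0 b 0 ∈ (mirrorPt : Set (Fin 4 → K))) ∧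
    (mirrorPt : Set (Fin 4 → K)) ≠ ∅ ∧ (mirrorPt : Set (Fin 4 → K)) ≠ mirrorL ∧
    (mirrorPt : Set (Fin 4 → K)) ≠ mirrorPt ∪ mirrorPw ∧
    ¬ (∀ x ∈ (mirrorPt : Set (Fin 4 → K)), swapPt x ∈ (mirrorPt : Set (Fin 4 → K))) := by
  refine ⟨Set.subset_union_left, ?_, ?_, ?_, ?_, ?_, ?_, ?_⟩
  · rintro c x ⟨h0, h1⟩
    exact ⟨by simp [shearPt, h0, h1], by simp [shearPt, h1]⟩
  · rintro l - x ⟨h0, h1⟩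
    exact ⟨by simp [scaleWPt, h0], by simp [scaleWPt, h1]⟩
  · intro b _
    exact ⟨by simp, by simp⟩
  · intro h
    have hmem : pt4 (0 : K) 0 0 0 ∈ (mirrorPt : Set (Fin 4 → K)) := ⟨by simp, by simp⟩
    rw [h] at hmem
    exact hmem
  · intro h
    have hmem : pt4 (0 : K) 0 0 1 ∈ (mirrorPt : Set (Fin 4 → K)) := ⟨by simp, by simp⟩
    rw [h] at hmem
    have := hmem.2.2
    simp at this
  · intro h
    have hmem : pt4 (0 : K) 1 0 0 ∈ (mirrorPt ∪ mirrorPw : Set (Fin 4 → K)) := Or.inr ⟨by simp, by simp⟩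
    rw [← h] at hmem
    have := hmem.2
    simp at this
  · intro h
    have hmem : pt4 (0 : K) 0 0 1 ∈ (mirrorPt : Set (Fin 4 → K)) := ⟨by simp, by simp⟩
    have h1 := (h _ hmem).2
    simp [swapPt] at h1

/-- the probe set for «no scaling»: `L` plus the mirrored lines `{z = t = 0, w = 1}` and `{z = w = 0, t = 1}`.
DEFINITION (support). -/
def mirrorProbe3 : Set (Fin 4 → K) :=
  {x | x 0 = 0 ∧ x 1 = 0 ∧ x 3 = 0} ∪ ({x | x 0 = 0 ∧ x 1 = 0 ∧ x 3 = 1} ∪ {x | x 0 = 0 ∧ x 3 = 0 ∧ x 1 = 1})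

/-- **PROBE 3 — no scaling** (`K` has an element `d ∉ {0, 1}`): `mirrorProbe3` is `σ̂`- and `τ̂`-stable, `w`-closed,
inside `P_t ∪ P_w`,
outside the trichotomy, and NOT `μ̂`-stable. [new; elementary] [folklore] -/
theorem mirror_probe_no_scaling (p : ℕ) {d : K} (hd0 : d ≠ 0) (hd1 : d ≠ 1) :
    (mirrorProbe3 : Set (Fin 4 → K)) ⊆ mirrorPt ∪ mirrorPw ∧
    (∀ x ∈ (mirrorProbe3 : Set (Fin 4 → K)), swapPt x ∈ (mirrorProbe3 : Set (Fin 4 → K))) ∧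
    (∀ c : K, ∀ x ∈ (mirrorProbe3 : Set (Fin 4 → K)), shearPt p c x ∈ (mirrorProbe3 : Set (Fin 4 → K))) ∧
    (∀ b : K, (∀ e : K, e ≠ 0 → pt4 0 0 b e ∈ (mirrorProbe3 : Set (Fin 4 → K))) → pt4 0 0 b 0 ∈ (mirrorProbe3 : Set (Fin 4 → K))) ∧
    (mirrorProbe3 : Set (Fin 4 → K)) ≠ ∅ ∧ (mirrorProbe3 : Set (Fin 4 → K)) ≠ mirrorL ∧
    (mirrorProbe3 : Set (Fin 4 → K)) ≠ mirrorPt ∪ mirrorPw ∧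
    ¬ (∀ l : K, l ≠ 0 → ∀ x ∈ (mirrorProbe3 : Set (Fin 4 → K)), scaleWPt p l x ∈ (mirrorProbe3 : Set (Fin 4 → K))) := by
  refine ⟨?_, ?_, ?_, ?_, ?_, ?_, ?_, ?_⟩
  · rintro x (⟨h0, h1, -⟩ | ⟨h0, h1, -⟩ | ⟨h0, h3, -⟩)
    · exact Or.inl ⟨h0, h1⟩
    · exact Or.inl ⟨h0, h1⟩
    · exact Or.inr ⟨h0, h3⟩
  · rintro x (⟨h0, h1, h3⟩ | ⟨h0, h1, h3⟩ | ⟨h0, h3, h1⟩)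
    · exact Or.inl ⟨by simp [swapPt, h0], by simp [swapPt, h3], by simp [swapPt, h1]⟩
    · exact Or.inr (Or.inr ⟨by simp [swapPt, h0], by simp [swapPt, h1], by simp [swapPt, h3]⟩)
    · exact Or.inr (Or.inl ⟨by simp [swapPt, h0], by simp [swapPt, h3], by simp [swapPt, h1]⟩)
  · rintro c x (⟨h0, h1, h3⟩ | ⟨h0, h1, h3⟩ | ⟨h0, h3, h1⟩)
    · exact Or.inl ⟨by simp [shearPt, h0, h1], by simp [shearPt, h1], by simp [shearPt, h3]⟩
    · exact Or.inr (Or.inl ⟨by simp [shearPt, h0, h1], by simp [shearPt, h1], by simp [shearPt, h3]⟩)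
    · exact Or.inr (Or.inr ⟨by simp [shearPt, h0, h3], by simp [shearPt, h3], by simp [shearPt, h1]⟩)
  · intro b _
    exact Or.inl ⟨by simp, by simp, by simp⟩
  · rw [← Set.nonempty_iff_ne_empty]
    exact ⟨pt4 0 0 0 0, Or.inl ⟨by simp, by simp, by simp⟩⟩
  · intro h
    have hmem : pt4 (0 : K) 0 0 1 ∈ (mirrorProbe3 : Set (Fin 4 → K)) := Or.inr (Or.inl ⟨by simp, by simp, by simp⟩)
    rw [h] at hmem
    have := hmem.2.2
    simp at this
  · intro h
    have hmem : pt4 (0 : K) 0 0 d ∈ (mirrorPt ∪ mirrorPw : Set (Fin 4 → K)) := Or.inl ⟨by simp, by simp⟩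
    rw [← h] at hmem
    rcases hmem with ⟨-, -, h3⟩ | ⟨-, -, h3⟩ | ⟨-, -, h1⟩
    · exact hd0 (by simpa using h3)
    · exact hd1 (by simpa using h3)
    · simp at h1
  · intro h
    have hmem : pt4 (0 : K) 0 0 1 ∈ (mirrorProbe3 : Set (Fin 4 → K)) := Or.inr (Or.inl ⟨by simp, by simp, by simp⟩)
    have h' := h d hd0 _ hmem
    rcases h' with ⟨-, -, h3⟩ | ⟨-, -, h3⟩ | ⟨-, -, h1⟩
    · exact hd0 (by simpa [scaleWPt] using h3)
    · exact hd1 (by simpa [scaleWPt] using h3)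
    · simp [scaleWPt] at h1

end MProbe

end Summit.ResolutionOfSingularities.ResolutionOfSingularities.Theorems.DeltaCutClasses
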